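import Mathlib.GroupTheory.GroupAction.Defs
import Mathlib.Topology.Compactness.Compact
import Mathlib.Topology.Constructions
import Mathlib.Topology.Order

/-!
# Finitely many open orbits on a compact space (Tier 5, N4.3 (A3) STEP 1)

Kernel form of the topological sentence of route/T5-N4-p5.md (A3) STEP 1:

«The compact space `Y := G(F)\G(𝔸)/K_f` is acted on by `G_∞`; each orbit is open
(the image of the open set `G_∞ g K_f` under the open quotient map), so there are finitely many,
`Y = ⊔_{i=1}^{h} …`, and each orbit is closed (complement of finitely many open orbits), hence
compact.»

Abstract setting: a group `G` acting on a topological space `Y` such that every orbit is open.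
Then the orbit space `MulAction.orbitRel.Quotient G Y` (with the quotient topology) is discrete,
every orbit is closed (hence clopen), and — when `Y` is compact — there are only finitely many
orbits and each of them is compact. No topology on `G` is used: the openness of the orbits is
the hypothesis, exactly as in the prose (where it comes from the openness of the quotient map).

Everything is Mathlib-only. The closedness of the orbits does not need compactness (the orbit
space being discrete, a singleton is closed and its preimage is the orbit); compactness is used
only for the finiteness of the orbit space and the compactness of each orbit.
-/

namespace Summit.Ventures.HodgeRepro2.T5CompactOpenOrbits

open MulAction Topology Set

variable {G : Type*} {Y : Type*} [Group G] [MulAction G Y] [TopologicalSpace Y]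

/-- The canonical map `Y → Y/G` onto the orbit space is a quotient map for the quotient
topology (Mathlib's `isQuotientMap_quotient_mk'`, instantiated at the setoid `orbitRel G Y`). -/
theorem isQuotientMap_mk :
    IsQuotientMap (Quotient.mk'' : Y → orbitRel.Quotient G Y) :=
  @isQuotientMap_quotient_mk' Y _ (orbitRel G Y)

/-- The canonical map `Y → Y/G` is continuous. -/
theorem continuous_mk : Continuous (Quotient.mk'' : Y → orbitRel.Quotient G Y) :=
  (isQuotientMap_mk (G := G)).continuous

omit [TopologicalSpace Y] in
/-- The fibre of `Y → Y/G` over a point `q` of the orbit space is the orbit `q.orbit`. -/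
theorem preimage_mk_singleton_eq_orbit (q : orbitRel.Quotient G Y) :
    (Quotient.mk'' : Y → orbitRel.Quotient G Y) ⁻¹' {q} = q.orbit := by
  ext a
  simp only [mem_preimage, mem_singleton_iff, orbitRel.Quotient.mem_orbit]

omit [TopologicalSpace Y] in
/-- The fibre of `Y → Y/G` over the class of `y` is the orbit of `y`. -/
theorem preimage_mk_singleton_mk_eq_orbit (y : Y) :
    (Quotient.mk'' : Y → orbitRel.Quotient G Y) ⁻¹' {Quotient.mk'' y} = orbit G y :=
  preimage_mk_singleton_eq_orbit (Quotient.mk'' y)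

omit [TopologicalSpace Y] in
/-- Every orbit `q.orbit` of a point of the orbit space is an honest orbit `orbit G y`. -/
theorem orbit_eq_orbit_out (q : orbitRel.Quotient G Y) : q.orbit = orbit G q.out :=
  orbitRel.Quotient.orbit_eq_orbit_out q Quotient.out_eq'

/-- If every orbit is open, then every `q.orbit`, `q` in the orbit space, is open. -/
theorem isOpen_orbit' (h : ∀ y : Y, IsOpen (orbit G y)) (q : orbitRel.Quotient G Y) :
    IsOpen q.orbit := by
  rw [orbit_eq_orbit_out]
  exact h _

/-- **Open orbits ⇒ discrete orbit space.** If every orbit of `G` on `Y` is open, the orbit space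
`Y/G` carries the discrete topology: the preimage of a singleton `{q}` is the open set `q.orbit`,
and `Y → Y/G` is a quotient map. -/
theorem discreteTopology_of_forall_isOpen_orbit (h : ∀ y : Y, IsOpen (orbit G y)) :
    DiscreteTopology (orbitRel.Quotient G Y) := by
  refine discreteTopology_iff_isOpen_singleton.mpr fun q => ?_
  rw [← (isQuotientMap_mk (G := G)).isOpen_preimage, preimage_mk_singleton_eq_orbit]
  exact isOpen_orbit' h q

/-- **Open orbits are closed.** If every orbit is open, every orbit is also closed: the orbit
space is discrete, so the singleton `{q}` is closed, and the orbit is its preimage under the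
continuous map `Y → Y/G`. (No compactness is needed for this.) -/
theorem isClosed_orbit (h : ∀ y : Y, IsOpen (orbit G y)) (y : Y) : IsClosed (orbit G y) := by
  haveI := discreteTopology_of_forall_isOpen_orbit h
  rw [← preimage_mk_singleton_mk_eq_orbit (G := G) y]
  exact (isClosed_discrete _).preimage (continuous_mk (G := G))

/-- If every orbit is open, every orbit is clopen. -/
theorem isClopen_orbit (h : ∀ y : Y, IsOpen (orbit G y)) (y : Y) : IsClopen (orbit G y) :=
  ⟨isClosed_orbit h y, h y⟩

section Compact

variable [CompactSpace Y]

/-- **Finitely many open orbits on a compact space.** If `Y` is compact and every orbit is open,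
the orbit space `Y/G` is finite: it is compact (continuous image of `Y`) and discrete. -/
theorem finite_orbitRel_quotient (h : ∀ y : Y, IsOpen (orbit G y)) :
    Finite (orbitRel.Quotient G Y) := by
  haveI := discreteTopology_of_forall_isOpen_orbit h
  exact finite_of_compact_of_discrete

/-- On a compact space with open orbits, the set of orbits `{orbit G y | y}` is a finite set of
subsets of `Y`. -/
theorem finite_range_orbit (h : ∀ y : Y, IsOpen (orbit G y)) :
    (range (orbit G : Y → Set Y)).Finite := by
  haveI := finite_orbitRel_quotient h
  have hrange : range (orbit G : Y → Set Y) =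
      range (orbitRel.Quotient.orbit : orbitRel.Quotient G Y → Set Y) := by
    ext s
    constructor
    · rintro ⟨y, rfl⟩
      exact ⟨Quotient.mk'' y, orbitRel.Quotient.orbit_mk y⟩
    · rintro ⟨q, rfl⟩
      exact ⟨q.out, (orbit_eq_orbit_out q).symm⟩
  rw [hrange]
  exact finite_range _

/-- **Finitely many representatives.** On a compact space with open orbits there is a finite set
`s` of points whose orbits cover `Y`: `Y = ⋃_{y ∈ s} orbit G y` (the `g_1, …, g_h` of STEP 1). -/
theorem exists_finset_iUnion_orbit_eq_univ (h : ∀ y : Y, IsOpen (orbit G y)) :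
    ∃ s : Finset Y, ⋃ y ∈ s, orbit G y = univ := by
  haveI := finite_orbitRel_quotient h
  haveI : Fintype (orbitRel.Quotient G Y) := Fintype.ofFinite _
  refine ⟨Finset.univ.map ⟨fun q : orbitRel.Quotient G Y => q.out, Quotient.out_injective⟩, ?_⟩
  refine eq_univ_of_forall fun y => ?_
  refine mem_iUnion₂.mpr ⟨(Quotient.mk'' y : orbitRel.Quotient G Y).out, ?_, ?_⟩
  · exact Finset.mem_map_of_mem _ (Finset.mem_univ _)
  · rw [← orbit_eq_orbit_out]
    exact orbitRel.Quotient.mem_orbit.mpr rfl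

/-- **Each orbit is compact.** On a compact space with open orbits, every orbit is closed, hence
compact. -/
theorem isCompact_orbit (h : ∀ y : Y, IsOpen (orbit G y)) (y : Y) : IsCompact (orbit G y) :=
  (isClosed_orbit h y).isCompact

/-- Each orbit of a point of the orbit space is compact. -/
theorem isCompact_orbit' (h : ∀ y : Y, IsOpen (orbit G y)) (q : orbitRel.Quotient G Y) :
    IsCompact q.orbit := by
  rw [orbit_eq_orbit_out]
  exact isCompact_orbit h _

/-- The orbit space is finite and each orbit is clopen and compact — STEP 1's sentence in one
statement. -/
theorem finite_and_forall_isClopen_isCompact (h : ∀ y : Y, IsOpen (orbit G y)) :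
    Finite (orbitRel.Quotient G Y) ∧ ∀ y : Y, IsClopen (orbit G y) ∧ IsCompact (orbit G y) :=
  ⟨finite_orbitRel_quotient h, fun y => ⟨isClopen_orbit h y, isCompact_orbit h y⟩⟩

end Compact

end Summit.Ventures.HodgeRepro2.T5CompactOpenOrbits
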